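import Mathlib
import Summits.NavierStokesRegularity.NavierStokesRegularity.Theorems.TaoLadderRungThreeGappedFrontRobustSelection
import HarnessLib

/-!
# `GappedFrontRobust`, the (step) clause: the TAIL CLOSING CONDITION is satisfiable (selection of the
  thin-tail threshold `ϑ`, the slack size `β₀` and the tail start `K₀`; helper for item
  stmt-NavierStokesRegularity-22114 `GappedFrontRobustV2`, STEP 1 of the assembly recipe)

HONEST FRAMING: an elementary real-number lemma; nothing is asserted about any table or flow; nothing here
concerns the Navier–Stokes equations. It discharges the scalar hypothesis `hclose` of
`…TailZone.pseudoFlowOn_tail_zone` with a CONSTANT target `ν` (and an arbitrary base constant `ν₀` at the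
shell `k₂ − 1`): for `q > 1`, `ν > 0` there are `ϑ > 0` (to be fed to `tailThin_shifted`), `β₀ > 0` (the
admissible tail slack, i.e. how small `η` must be) and `K₀` (how far out the tail zone must start) such that
`√2 √((4/3) m (25/32 + β q^{2K})) / (2 q^{K−1}) + C c (ϑ / q^{5/2}) x² ≤ ν` for all `β ∈ [0, β₀]`,
`K ≥ K₀`, `x ∈ {ν₀, ν}`.
-/

noncomputable section

-- the sub-problem namespace `Summit.NavierStokesRegularity.NavierStokesRegularity` repeats the summit name by design (D-0017)
set_option linter.dupNamespace false

namespace Summit.NavierStokesRegularity.NavierStokesRegularity.Theorems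

open Set Literature.Analysis.FluidPDE Literature.Analysis.FluidPDE.TaoCascade

namespace GappedFrontRobust

/-- `√(a + b) ≤ √a + √b` for `a, b ≥ 0`. [folklore] -/
private theorem sqrt_add_le_sqrt_add_sqrt {a b : ℝ} (ha : 0 ≤ a) (hb : 0 ≤ b) :
    Real.sqrt (a + b) ≤ Real.sqrt a + Real.sqrt b := by
  have h1 : a + b ≤ (Real.sqrt a + Real.sqrt b) ^ 2 := by
    nlinarith [Real.sq_sqrt ha, Real.sq_sqrt hb, Real.sqrt_nonneg a, Real.sqrt_nonneg b]
  calc Real.sqrt (a + b) ≤ Real.sqrt ((Real.sqrt a + Real.sqrt b) ^ 2) := Real.sqrt_le_sqrt h1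
    _ = Real.sqrt a + Real.sqrt b := Real.sqrt_sq (by positivity)

/-- **The tail closing condition is satisfiable.** See the module docstring. [folklore] -/
theorem exists_tail_closing {q ν ν₀ mR C c : ℝ} (hq : 1 < q) (hν : 0 < ν) (hν₀ : 0 ≤ ν₀)
    (hm : 0 ≤ mR) (hC : 0 ≤ C) (hc : 0 ≤ c) :
    ∃ ϑ β₀ : ℝ, 0 < ϑ ∧ 0 < β₀ ∧ ∃ K₀ : ℤ, ∀ β : ℝ, 0 ≤ β → β ≤ β₀ → ∀ K : ℤ, K₀ ≤ K →
      ∀ x : ℝ, (x = ν₀ ∨ x = ν) →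
        Real.sqrt 2 * Real.sqrt (4 / 3 * mR * (25 / 32 + β * q ^ ((2 : ℝ) * K))) /
            (2 * q ^ ((K - 1 : ℤ) : ℝ)) +
          C * c * (ϑ / q ^ ((5 : ℝ) / 2)) * x ^ 2 ≤ ν := by
  have hq0 : 0 < q := by linarith
  set M : ℝ := max ν₀ ν with hM
  have hM0 : 0 ≤ M := hν.le.trans (le_max_right _ _)
  -- ϑ : the pumping term ≤ ν/3
  set ϑ : ℝ := q ^ ((5 : ℝ) / 2) * ν / (3 * (C * c * M ^ 2 + 1)) with hϑ
  have hq52 : 0 < q ^ ((5 : ℝ) / 2) := Real.rpow_pos_of_pos hq0 _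
  have hden : 0 < 3 * (C * c * M ^ 2 + 1) := by positivity
  have hϑ0 : 0 < ϑ := by positivity
  -- β₀ : the slack part of the start junk ≤ ν/3
  set A : ℝ := 4 / 3 * mR with hA
  have hA0 : 0 ≤ A := by positivity
  set β₀ : ℝ := (2 * ν ^ 2 / 9) / (q ^ 2 * A + 1) with hβ₀
  have hβ₀0 : 0 < β₀ := by positivity
  -- K₀ : the junk part ≤ ν/3
  set A₀ : ℝ := Real.sqrt 2 / 2 * Real.sqrt (A * (25 / 32)) with hA₀def
  have hA₀0 : 0 ≤ A₀ := by positivity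
  obtain ⟨K₀, hK₀⟩ := exists_rpow_neg_mul_le_atTop hq one_pos
    (show 0 < ν / 3 / (A₀ + 1) by positivity)
  refine ⟨ϑ, β₀, hϑ0, hβ₀0, K₀ + 1, fun β hβ hββ₀ K hK x hx => ?_⟩
  -- the three pieces
  have hqK1 : 0 < q ^ ((K - 1 : ℤ) : ℝ) := Real.rpow_pos_of_pos hq0 _
  -- (i) pumping
  have hx2 : x ^ 2 ≤ M ^ 2 := by
    have hx0 : 0 ≤ x := by rcases hx with rfl | rfl <;> [exact hν₀; exact hν.le]
    have hxM : x ≤ M := by rcases hx with rfl | rfl <;> [exact le_max_left _ _; exact le_max_right _ _]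
    exact pow_le_pow_left₀ hx0 hxM 2
  have hpump : C * c * (ϑ / q ^ ((5 : ℝ) / 2)) * x ^ 2 ≤ ν / 3 := by
    have h1 : ϑ / q ^ ((5 : ℝ) / 2) = ν / (3 * (C * c * M ^ 2 + 1)) := by
      simp only [hϑ]; field_simp
    rw [h1]
    have h2 : C * c * (ν / (3 * (C * c * M ^ 2 + 1))) * x ^ 2 ≤
        C * c * (ν / (3 * (C * c * M ^ 2 + 1))) * M ^ 2 :=
      mul_le_mul_of_nonneg_left hx2 (by positivity)
    refine h2.trans ?_
    rw [show C * c * (ν / (3 * (C * c * M ^ 2 + 1))) * M ^ 2 =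
      (C * c * M ^ 2) / (C * c * M ^ 2 + 1) * (ν / 3) by field_simp]
    have h3 : (C * c * M ^ 2) / (C * c * M ^ 2 + 1) ≤ 1 := by
      rw [div_le_one (by positivity)]; linarith
    nlinarith
  -- (ii) + (iii) the start junk: split the square root
  have hsplit : Real.sqrt (4 / 3 * mR * (25 / 32 + β * q ^ ((2 : ℝ) * K))) ≤
      Real.sqrt (A * (25 / 32)) + Real.sqrt (A * β) * q ^ (K : ℝ) := by
    have h1 : 4 / 3 * mR * (25 / 32 + β * q ^ ((2 : ℝ) * K)) = A * (25 / 32) + A * β * q ^ ((2 : ℝ) * K) := by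
      simp only [hA]; ring
    rw [h1]
    refine (sqrt_add_le_sqrt_add_sqrt (by positivity)
      (by have := Real.rpow_pos_of_pos hq0 ((2 : ℝ) * K); positivity)).trans ?_
    have h2 : Real.sqrt (A * β * q ^ ((2 : ℝ) * K)) = Real.sqrt (A * β) * q ^ (K : ℝ) := by
      rw [show (2 : ℝ) * K = (K : ℝ) * ((2 : ℕ) : ℝ) by push_cast; ring, Real.rpow_mul_natCast hq0.le,
        Real.sqrt_mul (by positivity), Real.sqrt_sq (Real.rpow_pos_of_pos hq0 _).le]
    rw [h2]
  -- q^K / q^{K-1} = q and q^{-(K-1)} small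
  have hKK : q ^ (K : ℝ) = q ^ ((K - 1 : ℤ) : ℝ) * q := by
    rw [← Real.rpow_add_one hq0.ne']; push_cast; ring_nf
  have hjunk1 : Real.sqrt 2 * Real.sqrt (A * (25 / 32)) / (2 * q ^ ((K - 1 : ℤ) : ℝ)) ≤ ν / 3 := by
    have h1 := hK₀ (K - 1) (by linarith)
    rw [show -((1 : ℝ) * ((K - 1 : ℤ) : ℝ)) = -(((K - 1 : ℤ) : ℝ)) by ring, Real.rpow_neg hq0.le] at h1
    have h2 : Real.sqrt 2 * Real.sqrt (A * (25 / 32)) / (2 * q ^ ((K - 1 : ℤ) : ℝ)) =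
        A₀ * (q ^ ((K - 1 : ℤ) : ℝ))⁻¹ := by
      simp only [hA₀def]; field_simp
    rw [h2]
    calc A₀ * (q ^ ((K - 1 : ℤ) : ℝ))⁻¹ ≤ (A₀ + 1) * (q ^ ((K - 1 : ℤ) : ℝ))⁻¹ := by
          gcongr; linarith
      _ ≤ (A₀ + 1) * (ν / 3 / (A₀ + 1)) := mul_le_mul_of_nonneg_left h1 (by positivity)
      _ = ν / 3 := by field_simp
  have hjunk2 : Real.sqrt 2 * (Real.sqrt (A * β) * q ^ (K : ℝ)) / (2 * q ^ ((K - 1 : ℤ) : ℝ)) ≤ ν / 3 := by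
    rw [hKK]
    have h1 : Real.sqrt 2 * (Real.sqrt (A * β) * (q ^ ((K - 1 : ℤ) : ℝ) * q)) /
        (2 * q ^ ((K - 1 : ℤ) : ℝ)) = Real.sqrt 2 / 2 * q * Real.sqrt (A * β) := by
      field_simp
    rw [h1]
    -- (√2/2 · q · √(Aβ))² = (1/2) q² A β ≤ (1/2) q² A β₀ ≤ ν²/9
    have hAβ : A * β ≤ A * β₀ := mul_le_mul_of_nonneg_left hββ₀ hA0
    have h3 : q ^ 2 * A * β₀ ≤ 2 * ν ^ 2 / 9 := by
      simp only [hβ₀]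
      rw [show q ^ 2 * A * (2 * ν ^ 2 / 9 / (q ^ 2 * A + 1)) =
        (q ^ 2 * A) / (q ^ 2 * A + 1) * (2 * ν ^ 2 / 9) by field_simp]
      have : (q ^ 2 * A) / (q ^ 2 * A + 1) ≤ 1 := by
        rw [div_le_one (by positivity)]; linarith
      nlinarith
    have h6 : q ^ 2 * (A * β) ≤ 2 * ν ^ 2 / 9 := by
      calc q ^ 2 * (A * β) ≤ q ^ 2 * (A * β₀) := mul_le_mul_of_nonneg_left hAβ (sq_nonneg q)
        _ = q ^ 2 * A * β₀ := by ring
        _ ≤ 2 * ν ^ 2 / 9 := h3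
    have h4 : (Real.sqrt 2 / 2 * q * Real.sqrt (A * β)) ^ 2 ≤ (ν / 3) ^ 2 := by
      have hsq : (Real.sqrt 2 / 2 * q * Real.sqrt (A * β)) ^ 2 = 1 / 2 * (q ^ 2 * (A * β)) := by
        rw [mul_pow, mul_pow, div_pow, Real.sq_sqrt (by norm_num), Real.sq_sqrt (by positivity)]
        ring
      rw [hsq, show (ν / 3) ^ 2 = ν ^ 2 / 9 by ring]
      linarith
    have h5 : 0 ≤ Real.sqrt 2 / 2 * q * Real.sqrt (A * β) := by positivity
    exact (pow_le_pow_iff_left₀ h5 (by positivity) two_ne_zero).mp h4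
  -- assemble
  have hsq2 : 0 ≤ Real.sqrt 2 := Real.sqrt_nonneg 2
  calc Real.sqrt 2 * Real.sqrt (4 / 3 * mR * (25 / 32 + β * q ^ ((2 : ℝ) * K))) /
          (2 * q ^ ((K - 1 : ℤ) : ℝ)) + C * c * (ϑ / q ^ ((5 : ℝ) / 2)) * x ^ 2
      ≤ Real.sqrt 2 * (Real.sqrt (A * (25 / 32)) + Real.sqrt (A * β) * q ^ (K : ℝ)) /
          (2 * q ^ ((K - 1 : ℤ) : ℝ)) + ν / 3 := by
        gcongr
    _ = Real.sqrt 2 * Real.sqrt (A * (25 / 32)) / (2 * q ^ ((K - 1 : ℤ) : ℝ)) +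
          Real.sqrt 2 * (Real.sqrt (A * β) * q ^ (K : ℝ)) / (2 * q ^ ((K - 1 : ℤ) : ℝ)) + ν / 3 := by
        ring
    _ ≤ ν / 3 + ν / 3 + ν / 3 := by gcongr
    _ = ν := by ring

end GappedFrontRobust

end Summit.NavierStokesRegularity.NavierStokesRegularity.Theorems

end
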